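import Literature.IUT.HodgeArakelov.MonoThetaFromGroupsProp13Proofs
import HarnessLib

/-!
# [IUTchII] Proposition 1.3 (iii) — statements-first SUB-DAG of the printed proof (kurims p. 27 l. 1–7)

S. Mochizuki, *Inter-universal Teichmüller theory II*, §1, Proposition 1.3 "(Compatibility of Cyclotomic
Rigidity Isomorphisms)" (iii), kurims manuscript (Dec. 2020) p. 26 (statement) and p. 27 l. 1–7 (proof), read on
the page (`paper:url-5036b4059555`). Record-only typing under the claim key `Mochizuki2012` (D-0012, disputed);
abc-iut cell, HUMAN RULING D-0068 (1) «statements-first sub-DAG» (director rule 2026-08-25T23:59:05Z queue (1);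
dag SUBDAG-WANTED v0 00:03:18Z, node `IUTchII:Prop1.3(iii)`; seat abc-iut-w5-d064; table
`plan/L6/SUBDAG-IUTchII-Prop-13iii.md`).

THE PRINTED PROOF is one sentence: "Assertion (iii) follows immediately from the fact that in the situation
where the Frobenioid `𝒞` involved is not just 'some abstract category', but rather arises from familiar objects
of scheme theory [cf. the theory of [EtTh], §1!], both isomorphisms `(*mono-Θ)`, `(*bs-Gal)` coincide with the
conventional identification between the cyclotomes involved that arises from conventional scheme theory."
abc-iut-L6-t1 typed (iii) as the equation `Prop13_iii C Z B : Z.monoTheta C = B.bsGal` (`MonoThetaFromGroups`,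
p406189) with `(*bs-Gal)` DEFINED as the printed composite
`(l·Δ_Θ)_S ⊗ ℤ/Nℤ →[corr_intS] μ_Ẑ(Π_X) →[(Cor 1.10 (c))⁻¹] μ_Ẑ(G_k) →[(Rmk 3.2.1)⁻¹] μ_Ẑ(M_TM) →[corr_muN⁻¹] μ_N(S)`;
abc-iut-w4-d042 (`MonoThetaFromGroupsProp13Proofs`, p411824) proved the printed inference
`prop13_iii_of_conventional` (both isomorphisms conventional ⇒ they coincide) and reduced (iii) to ONE residual
equation `hgal` ("`(*bs-Gal)` read in `𝒞`'s cyclotomes `= ρ_{B_N}`", GAP-LEDGER G-w4d042-1).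

THIS FILE cuts that residual along the FOUR constituents the printed definition of `(*bs-Gal)` names, each an
OPEN SUB-NODE (a `def … : Prop` over the existing interfaces — NOT a FACT-LIST fact, D-0067 (1)), relative to a
DATUM `κ : ConventionalCyclotomes Z B ν` = "the conventional identification between the cyclotomes involved that
arises from conventional scheme theory" (all five cyclotomes of Prop. 1.3 (i)(ii) identified with one reference
cyclotome `ν`, in the scheme-theoretic situation `μ_N(k̄)`):
* r1 `MonoThetaConventional` — "`(*mono-Θ)` coincides with the conventional identification" ([EtTh] Prop. 5.5 /
  Lemma 5.9 (v): the Frobenioid-theoretic, Kummer-determined rigidity isomorphism; owner L2);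
* r2 `Cor110cNatural` — "the natural isomorphism `μ_Ẑ(G_k) ⥲ μ_Ẑ(Π_X)` of [AbsTopIII], Corollary 1.10, (c)"
  is the conventional one (THE item of G-w4d042-1: the tree's `AbsoluteAnabelian.CurveModel.Cor_1_10_ii_c` is
  bare existence; owner L4-t1);
* r3 `Rmk321Natural` — "the natural isomorphism `μ_Ẑ(M_TM) ⥲ μ_Ẑ(G)` of [AbsTopIII], Remark 3.2.1" is the
  conventional one ([FrdII] Thm. 2.4 (ii); owner L4-t2);
* r4 `CorrMuNConventional` ∧ `CorrIntSConventional` — the two "correspondences of notation" of (i)/(ii)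
  (`μ_N(S) ↔ μ_Ẑ(M_TM) ⊗ ℤ/Nℤ`, `(l·Δ_Θ)_S ⊗ ℤ/Nℤ ↔ μ_Ẑ(Π_X) ⊗ ℤ/Nℤ`; [AbsTopIII] Thm. 1.9 (b), Rmk. 1.10.1 (ii),
  [IUTchI] Rmk. 3.1.2 (iii)) are conventional (owners L6-t1 / L2-t4 merge);
and PROVES the compositions: r2 ∧ r3 ∧ r4 ⇒ "`(*bs-Gal)` is conventional" (`bsGal_conventional`), r1 ∧ … ∧ r4 ⇒
`Prop13_iii C Z B` (`prop13_iii_of_subnodes`, via w4-d042's `prop13_iii_of_conventional`), and r2 ∧ r3 ∧ r4 +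
"`ρ_{B_N}` is conventional" ⇒ w4-d042's residual `hgal` (`bsGal_read_eq_rho_of_subnodes`).

VACUITY CAVEAT, made kernel-visible (`ConventionalCyclotomes.ofBsGal`, `prop13_iii_iff_monoThetaConventional_ofBsGal`):
`κ` is a BINDER. Instantiated tautologically FROM `B` itself (reference cyclotome `μ_N(S)`, identifications := the
composites through `B`'s own arrows), r2–r4 hold by `rfl` and r1 becomes (iii) itself; the mathematical content of
the cut lies in PINNING `κ` to the scheme-theoretic identifications of [EtTh] §1 / [AbsTopIII] (owners L2, L4) — which
is exactly what the printed proof appeals to. Deliberately NOT here: any construction of `κ` for the genuine data;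
any claim that r1–r4 hold; anything bearing on [IUTchIII] Cor. 3.12 (no side taken). typed ≠ proved.
-/

namespace Literature.IUT.HodgeArakelov

universe u w

open CategoryTheory
open Literature.AnabelianGeometry.EtaleTheta

variable {S : ThetaSetting.{u}}

namespace Prop13Sub

variable {F : TemperedFrobenioidData S} {E : EnvOfFrobenioid F}

/-- DATA: "the conventional identification between the cyclotomes involved that arises from conventional scheme
theory" ([IUTchII] Prop. 1.3, proof of (iii), kurims p. 27 l. 5–7) — the five cyclotomes of Prop. 1.3 (i)(ii)
(`(l·Δ_Θ)_S ⊗ ℤ/Nℤ`, `μ_N(S)`, `μ_Ẑ(M_TM) ⊗ ℤ/Nℤ`, `μ_Ẑ(G_k) ⊗ ℤ/Nℤ`, `μ_Ẑ(Π_X) ⊗ ℤ/Nℤ`) each identified with ONE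
reference cyclotome `ν` (in the scheme-theoretic situation of [EtTh] §1: `ν = μ_N(k̄)`). A binder: nothing asserts
that a given `κ` IS the scheme-theoretic identification (see `ofBsGal` for the tautological inhabitant).
[claim: Mochizuki2012, status: disputed] (IUTchII §1 Prop 1.3 (iii) proof, kurims p.27 l.5–7) -/
structure ConventionalCyclotomes (Z : FrobenioidCyclotomes E) (B : BsGalData Z) (ν : Type w) [Group ν] where
  /-- `(l·Δ_Θ)_S ⊗ ℤ/Nℤ ⥲ ν` -/
  idIntS : Z.intS.carrier ≃* ν
  /-- `μ_N(S) ⥲ ν` -/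
  idMuN : Z.muN ≃* ν
  /-- `μ_Ẑ(M_TM) ⊗ ℤ/Nℤ ⥲ ν` -/
  idMTM : B.muMTM ≃* ν
  /-- `μ_Ẑ(G_k) ⊗ ℤ/Nℤ ⥲ ν` (`= μ_Ẑ(G)`) -/
  idG : B.muG ≃* ν
  /-- `μ_Ẑ(Π_X) ⊗ ℤ/Nℤ ⥲ ν` -/
  idPiX : B.muPiX ≃* ν

variable {Z : FrobenioidCyclotomes E} {B : BsGalData Z} {ν : Type w} [Group ν]

/-- SUB-NODE r1 «`(*mono-Θ)` coincides with the conventional identification» (proof of (iii), p. 27 l. 5–6): the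
Def. 1.1 (ii) / [EtTh] Cor. 2.19 (i) cyclotomic rigidity isomorphism, transported to `(l·Δ_Θ)_S ⊗ ℤ/Nℤ ⥲ μ_N(S)`
(abc-iut-L6-t1's `FrobenioidCyclotomes.monoTheta`), becomes the identity of `ν` under `κ`. By [EtTh] Lemma 5.9 (v)
(abc-iut-L2-t4 `ThetaFrobenioid.CycRigidityCoincide`, abc-iut-w4-d042 `monoTheta_read_eq`) this is the statement
that the Kummer-determined `ρ_{B_N}` of [EtTh] Prop. 5.5 is conventional (`monoThetaConventional_of_rho`). OPEN
sub-node (owner L2). [claim: Mochizuki2012, status: disputed] (IUTchII §1 Prop 1.3 (iii), kurims p.27 l.5–6) -/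
def MonoThetaConventional (C : CyclotomicRigidity E.recon) (κ : ConventionalCyclotomes Z B ν) : Prop :=
  ∀ x, κ.idMuN (Z.monoTheta C x) = κ.idIntS x

/-- SUB-NODE r2 «the natural isomorphism `μ_Ẑ(G_k) ⥲ μ_Ẑ(Π_X)` of [AbsTopIII], Corollary 1.10, (c)» (statement of
(ii), p. 26) is the conventional identification: abc-iut-L6-t1's field `BsGalData.corGk_PiX` becomes the identity
of `ν` under `κ`. This is THE missing item of GAP-LEDGER G-w4d042-1 (the tree's
`Literature.AnabelianGeometry.AbsoluteAnabelian.CurveModel.Cor_1_10_ii_c` types bare existence of an equivariant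
isomorphism and does not single out the natural one). OPEN sub-node (owner L4-t1).
[claim: Mochizuki2012, status: disputed] (IUTchII §1 Prop 1.3 (ii), kurims p.26; [AbsTopIII] Cor 1.10 (c)) -/
def Cor110cNatural (κ : ConventionalCyclotomes Z B ν) : Prop :=
  ∀ y, κ.idPiX (B.corGk_PiX y) = κ.idG y

/-- SUB-NODE r3 «the natural isomorphism `μ_Ẑ(M_TM) ⥲ μ_Ẑ(G)` of [AbsTopIII], Remark 3.2.1» (statement of (ii),
p. 26; the lead-in of Prop. 1.3 cites "[cf. also [FrdII], Theorem 2.4, (ii)]") is the conventional identification: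
`BsGalData.corMTM_G` becomes the identity of `ν` under `κ`. OPEN sub-node (owner L4-t2).
[claim: Mochizuki2012, status: disputed] (IUTchII §1 Prop 1.3 (ii), kurims p.26; [AbsTopIII] Rmk 3.2.1) -/
def Rmk321Natural (κ : ConventionalCyclotomes Z B ν) : Prop :=
  ∀ y, κ.idG (B.corMTM_G y) = κ.idMTM y

/-- SUB-NODE r4a, the correspondence of notation «`μ_N(S)` corresponds to `μ_Ẑ(M_TM) ⊗ (ℤ/Nℤ)`» ((ii), p. 26;
[AbsTopIII] Def. 3.1 (v)) is conventional: `BsGalData.corr_muN` becomes the identity of `ν` under `κ`. OPEN sub-node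
(owners L6-t1 / L2-t4 merge). [claim: Mochizuki2012, status: disputed] (IUTchII §1 Prop 1.3 (ii), kurims p.26) -/
def CorrMuNConventional (κ : ConventionalCyclotomes Z B ν) : Prop :=
  ∀ u, κ.idMTM (B.corr_muN u) = κ.idMuN u

/-- SUB-NODE r4b, the correspondence of notation «`(l·Δ_Θ)_S ⊗ (ℤ/Nℤ)` corresponds to `μ_Ẑ(Π_X) ⊗ (ℤ/Nℤ)`»
((ii), p. 26; [AbsTopIII] Thm. 1.9 (b), Rmk. 1.10.1 (ii); [IUTchI] Rmk. 3.1.2 (iii)) is conventional: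
`BsGalData.corr_intS` becomes the identity of `ν` under `κ`. OPEN sub-node (owners L6-t1 / L2-t4 merge).
[claim: Mochizuki2012, status: disputed] (IUTchII §1 Prop 1.3 (ii), kurims p.26) -/
def CorrIntSConventional (κ : ConventionalCyclotomes Z B ν) : Prop :=
  ∀ x, κ.idPiX (B.corr_intS x) = κ.idIntS x

/-- COMPOSITION (PROVED): r2 ∧ r3 ∧ r4 ⇒ «`(*bs-Gal)` coincides with the conventional identification» — the
printed composite `corr_intS ≫ (Cor 1.10 (c))⁻¹ ≫ (Rmk 3.2.1)⁻¹ ≫ corr_muN⁻¹` (abc-iut-L6-t1's `BsGalData.bsGal`)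
becomes the identity of `ν` under `κ`. Pure diagram chase. [claim: Mochizuki2012, status: disputed]
(IUTchII §1 Prop 1.3 (ii)/(iii), kurims pp.26–27) -/
theorem bsGal_conventional (κ : ConventionalCyclotomes Z B ν) (h2 : Cor110cNatural κ) (h3 : Rmk321Natural κ)
    (h4a : CorrMuNConventional κ) (h4b : CorrIntSConventional κ) (x : Z.intS.carrier) :
    κ.idMuN (B.bsGal x) = κ.idIntS x := by
  -- unfold the printed composite
  show κ.idMuN (B.corr_muN.symm (B.corMTM_G.symm (B.corGk_PiX.symm (B.corr_intS x)))) = κ.idIntS x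
  have e1 : κ.idMuN (B.corr_muN.symm (B.corMTM_G.symm (B.corGk_PiX.symm (B.corr_intS x)))) =
      κ.idMTM (B.corMTM_G.symm (B.corGk_PiX.symm (B.corr_intS x))) := by
    rw [← h4a (B.corr_muN.symm _), MulEquiv.apply_symm_apply]
  have e2 : κ.idMTM (B.corMTM_G.symm (B.corGk_PiX.symm (B.corr_intS x))) =
      κ.idG (B.corGk_PiX.symm (B.corr_intS x)) := by
    rw [← h3 (B.corMTM_G.symm _), MulEquiv.apply_symm_apply]
  have e3 : κ.idG (B.corGk_PiX.symm (B.corr_intS x)) = κ.idPiX (B.corr_intS x) := by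
    rw [← h2 (B.corGk_PiX.symm _), MulEquiv.apply_symm_apply]
  rw [e1, e2, e3, h4b]

/-- ASSEMBLY (PROVED): r1 ∧ r2 ∧ r3 ∧ r4 ⇒ **[IUTchII] Prop. 1.3 (iii)** as typed (`Prop13_iii C Z B :
Z.monoTheta C = B.bsGal`), by abc-iut-w4-d042's `prop13_iii_of_conventional` — the printed inference "both
isomorphisms coincide with the conventional identification … [hence] coincide" with its two hypotheses split into
the four constituents the statement of Prop. 1.3 names. [claim: Mochizuki2012, status: disputed]
(IUTchII §1 Prop 1.3 (iii), kurims p.27 l.1–7) -/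
theorem prop13_iii_of_subnodes (C : CyclotomicRigidity E.recon) (κ : ConventionalCyclotomes Z B ν)
    (h1 : MonoThetaConventional C κ) (h2 : Cor110cNatural κ) (h3 : Rmk321Natural κ)
    (h4a : CorrMuNConventional κ) (h4b : CorrIntSConventional κ) : Prop13_iii C Z B :=
  prop13_iii_of_conventional C Z B κ.idIntS κ.idMuN h1 (bsGal_conventional κ h2 h3 h4a h4b)

/-- BRIDGE TO THE RESIDUAL OF RECORD (PROVED): r2 ∧ r3 ∧ r4 together with «the Kummer-determined `ρ_{B_N}` of [EtTh]
Prop. 5.5, read in `𝒞`'s cyclotomes through the identifications `a`, `b` of abc-iut-w4-d042's `monoTheta_read_eq`,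
is the conventional identification» (`hρ`) yield w4-d042's residual equation `hgal` of
`prop13_iii_of_cycRigidityCoincide` / GAP-LEDGER G-w4d042-1: `∀ x, b ((*bs-Gal) x) = ρ_{B_N} (a x)`. So the node
`IUTchII:Prop1.3(iii)` closes from [EtTh] Lemma 5.9 (v) + `hρ` + r2 + r3 + r4.
[claim: Mochizuki2012, status: disputed] (IUTchII §1 Prop 1.3 (iii), kurims p.27; [EtTh] Prop 5.5, Lem 5.9 (v)) -/
theorem bsGal_read_eq_rho_of_subnodes (𝔉 : ThetaFrobenioid.{w} F.C F.D) (hB : 𝔉.IsThetaSaturated 𝔉.BN)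
    (ρ : FrobenioidCyclotomicRigidity.RigidityFamily 𝔉)
    (a : Z.intS.carrier ≃* 𝔉.lDeltaModN 𝔉.BN) (b : Z.muN ≃* 𝔉.muTorsion 𝔉.BN 𝔉.N)
    {ν' : Type w} [Group ν'] (κ : ConventionalCyclotomes Z B ν')
    (hρ : ∀ x, κ.idMuN (b.symm (ρ 𝔉.BN hB (a x))) = κ.idIntS x)
    (h2 : Cor110cNatural κ) (h3 : Rmk321Natural κ) (h4a : CorrMuNConventional κ)
    (h4b : CorrIntSConventional κ) (x : Z.intS.carrier) :
    b (B.bsGal x) = ρ 𝔉.BN hB (a x) := by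
  have h : κ.idMuN (B.bsGal x) = κ.idMuN (b.symm (ρ 𝔉.BN hB (a x))) := by
    rw [bsGal_conventional κ h2 h3 h4a h4b, hρ]
  have h' : B.bsGal x = b.symm (ρ 𝔉.BN hB (a x)) := κ.idMuN.injective h
  rw [h', MulEquiv.apply_symm_apply]

/-- r1 FROM [EtTh] (PROVED): [EtTh] Lemma 5.9 (v) for the slot `a⁻¹ ≫ (*mono-Θ) ≫ b` (abc-iut-L2-t4's
`ThetaFrobenioid.CycRigidityCoincide`, hypothesis `h59v`, via abc-iut-w4-d042's `monoTheta_read_eq`) together with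
«`ρ_{B_N}` is conventional» (`hρ`) gives sub-node r1. So r1's content beyond the landed [EtTh] §5 typing is `hρ`
alone. [claim: Mochizuki2012, status: disputed] (IUTchII §1 Prop 1.3 (iii), kurims p.27; [EtTh] Lem 5.9 (v)) -/
theorem monoThetaConventional_of_rho (𝔉 : ThetaFrobenioid.{w} F.C F.D) (hB : 𝔉.IsThetaSaturated 𝔉.BN)
    (ρ : FrobenioidCyclotomicRigidity.RigidityFamily 𝔉) (C : CyclotomicRigidity E.recon)
    (a : Z.intS.carrier ≃* 𝔉.lDeltaModN 𝔉.BN) (b : Z.muN ≃* 𝔉.muTorsion 𝔉.BN 𝔉.N)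
    (h59v : 𝔉.CycRigidityCoincide (a.symm.trans ((Z.monoTheta C).trans b)) ρ hB)
    {ν' : Type w} [Group ν'] (κ : ConventionalCyclotomes Z B ν')
    (hρ : ∀ x, κ.idMuN (b.symm (ρ 𝔉.BN hB (a x))) = κ.idIntS x) : MonoThetaConventional C κ := by
  intro x
  have h : Z.monoTheta C x = b.symm (ρ 𝔉.BN hB (a x)) := by
    apply b.injective
    rw [monoTheta_read_eq 𝔉 hB ρ C Z a b h59v x, MulEquiv.apply_symm_apply]
  rw [h, hρ]

/-! ## Vacuity caveat, kernel-visible -/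

/-- The TAUTOLOGICAL inhabitant of `ConventionalCyclotomes`: reference cyclotome `ν := μ_N(S)`, every
identification := the composite through `B`'s own arrows (`(*bs-Gal)` for `(l·Δ_Θ)_S ⊗ ℤ/Nℤ`). Recorded ONLY to
show what does not count as "the conventional identification … from scheme theory" (non-Prop plumbing).
[folklore] -/
def ConventionalCyclotomes.ofBsGal (B : BsGalData Z) : ConventionalCyclotomes Z B Z.muN where
  idIntS := B.bsGal
  idMuN := MulEquiv.refl _
  idMTM := B.corr_muN.symm
  idG := B.corMTM_G.symm.trans B.corr_muN.symm
  idPiX := B.corGk_PiX.symm.trans (B.corMTM_G.symm.trans B.corr_muN.symm)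

/-- At the tautological `κ := ofBsGal B` the sub-nodes r2, r3, r4a, r4b hold by `rfl` … (unfolding of the
printed definition of `(*bs-Gal)`, Prop. 1.3 (ii) p. 26). [claim: Mochizuki2012, status: disputed]
(IUTchII §1 Prop 1.3 (ii), kurims p.26) -/
theorem subnodes_ofBsGal (B : BsGalData Z) :
    Cor110cNatural (ConventionalCyclotomes.ofBsGal B) ∧ Rmk321Natural (ConventionalCyclotomes.ofBsGal B) ∧
      CorrMuNConventional (ConventionalCyclotomes.ofBsGal B) ∧
        CorrIntSConventional (ConventionalCyclotomes.ofBsGal B) := by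
  refine ⟨fun y => ?_, fun y => ?_, fun u => ?_, fun x => rfl⟩
  · show B.corr_muN.symm (B.corMTM_G.symm (B.corGk_PiX.symm (B.corGk_PiX y))) =
      B.corr_muN.symm (B.corMTM_G.symm y)
    rw [MulEquiv.symm_apply_apply]
  · show B.corr_muN.symm (B.corMTM_G.symm (B.corMTM_G y)) = B.corr_muN.symm y
    rw [MulEquiv.symm_apply_apply]
  · show B.corr_muN.symm (B.corr_muN u) = u
    rw [MulEquiv.symm_apply_apply]

/-- … and r1 becomes (iii) ITSELF: `MonoThetaConventional C (ofBsGal B) ↔ Prop13_iii C Z B`. Hence the cut carries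
content only for a `κ` pinned to the scheme-theoretic identifications ([EtTh] §1, [AbsTopIII] §1/§3 — owners L2, L4),
which is precisely the appeal of the printed proof (p. 27 l. 5–7). [claim: Mochizuki2012, status: disputed]
(IUTchII §1 Prop 1.3 (iii), kurims p.27 l.5–7) -/
theorem prop13_iii_iff_monoThetaConventional_ofBsGal (C : CyclotomicRigidity E.recon) (B : BsGalData Z) :
    Prop13_iii C Z B ↔ MonoThetaConventional C (ConventionalCyclotomes.ofBsGal B) := by
  rw [prop13_iii_iff]
  exact Iff.rfl

end Prop13Sub

end Literature.IUT.HodgeArakelov
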